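import Mathlib.Algebra.BigOperators.Ring.Finset
import Mathlib.Algebra.Order.BigOperators.Group.Finset
import Mathlib.Data.Fintype.BigOperators
import Mathlib.Data.Fintype.Pi
import Mathlib.Data.Finset.Powerset
import Mathlib.Tactic.Ring
import Mathlib.Tactic.Positivity
import HarnessLib

/-!
# Counting bad coin outcomes coordinate-wise (the union bound of Hirahara's soundness proof)

Topic `Computability/Complexity`. The last, purely combinatorial step of the soundness analysis of
Hirahara's reduction from CMMSA to `MCSP*` (ECCC TR22-119, proof of Lemma 8.3, pp. 28–29, and of
Thm. 8.5, p. 31), in the counting form used by the tree's formalisation: the coins of the reduction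
are a tuple `F = (f_k)_{k ∈ K}` of independent uniform objects (`f_k ∈ Φ k`, the random functions of
the variables `k`), a "test" `g` (a small circuit) that is consistent with the sample determined by
`F` forces a set `B(g, F) = {k | Q g k (f_k)}` of HEAVY total weight (`> W₀`) all of whose members
satisfy a per-coordinate predicate `Q g k` ("`f_k` is approximately described by `g` plus short
advice") of small density (`#{Q g k} · 2^{c_k} ≤ |Φ k|`). Then few coin tuples admit a consistent
test:

* `card_filter_forall_eq` — **product structure**: `#{F | ∀ k ∈ S, Q k (F k)} = ∏_{k∈S} #{Q k} · ∏_{k∉S} |Φ k|`;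
* `card_filter_forall_mul_le` — with densities, `#{F | ∀ k ∈ S, Q k (F k)} · 2^{∑_{k∈S} c_k} ≤ |∏ Φ|`;
* `card_filter_exists_consistent_mul_le` — **the bound**: if consistency forces a heavy `B(g,F)`
  and every heavy set collects `≥ m` density bits, then
  `#{F | ∃ g ∈ 𝒢, Cons g F} · 2^m ≤ |𝒢| · 2^{|K|} · |∏ Φ|`
  (union over the tests and over the `≤ 2^{|K|}` candidate heavy sets; in Hirahara's proof:
  "`(1 - o(1)) λ w(B) ≤ |M|`", summed over `B` and over the programs `M`).

## References

* S. Hirahara, *NP-hardness of learning programs and partial MCSP*, ECCC TR22-119, proof of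
  Lemma 8.3 (soundness, pp. 28–29: `K^D(f_B) ≤ o(λ w(B))`, `w(B) < θ`) and proof of Thm. 8.5 (p. 31)
  [Hirahara2022PartialMCSP].
-/

namespace Literature.Computability.Complexity

open Finset

namespace SoundnessCounting

open scoped Classical

variable {K : Type} [Fintype K] [DecidableEq K] {Φ : K → Type} [∀ k, Fintype (Φ k)]

/-- **Product structure.** For per-coordinate predicates, the tuples satisfying them on `S` number
`∏_{k ∈ S} #{Q k} · ∏_{k ∉ S} |Φ k|`. [folklore] -/
theorem card_filter_forall_eq (S : Finset K) (Q : (k : K) → Φ k → Prop) :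
    ((univ : Finset ((k : K) → Φ k)).filter fun F => ∀ k ∈ S, Q k (F k)).card =
      (∏ k ∈ S, ((univ : Finset (Φ k)).filter (Q k)).card) * ∏ k ∈ Sᶜ, Fintype.card (Φ k) := by
  -- as a subtype, the filter is a product of subtypes
  have h1 : ((univ : Finset ((k : K) → Φ k)).filter fun F => ∀ k ∈ S, Q k (F k)).card =
      Fintype.card {F : (k : K) → Φ k // ∀ k, k ∈ S → Q k (F k)} := by
    rw [Fintype.card_subtype]
  rw [h1, Fintype.card_congr (Equiv.subtypePiEquivPi (p := fun k φ => k ∈ S → Q k φ)), Fintype.card_pi]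
  -- split the product over `S` and its complement
  rw [← Finset.prod_mul_prod_compl S]
  congr 1
  · refine Finset.prod_congr rfl fun k hk => ?_
    rw [Fintype.card_subtype]
    congr 1
    ext φ
    simp [hk]
  · refine Finset.prod_congr rfl fun k hk => ?_
    rw [mem_compl] at hk
    rw [Fintype.card_subtype]
    have : ((univ : Finset (Φ k)).filter fun φ => k ∈ S → Q k φ) = univ := by
      ext φ; simp [hk]
    rw [this, card_univ]

/-- **Densities multiply.** If `#{Q k} · 2^{c k} ≤ |Φ k|` for `k ∈ S` then
`#{F | ∀ k ∈ S, Q k (F k)} · 2^{∑_{k∈S} c k} ≤ |∏ Φ|`. [cite: Hirahara2022PartialMCSP, proof of Lemma 8.3 (summing K^D(f_k) ≤ o(λ w(k)) over k ∈ B)] -/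
theorem card_filter_forall_mul_le (S : Finset K) (Q : (k : K) → Φ k → Prop)
    (c : K → ℕ) (hdens : ∀ k ∈ S, ((univ : Finset (Φ k)).filter (Q k)).card * 2 ^ c k ≤ Fintype.card (Φ k)) :
    ((univ : Finset ((k : K) → Φ k)).filter fun F => ∀ k ∈ S, Q k (F k)).card * 2 ^ (∑ k ∈ S, c k) ≤
      Fintype.card ((k : K) → Φ k) := by
  rw [card_filter_forall_eq, Fintype.card_pi, ← Finset.prod_mul_prod_compl S, ← Finset.prod_pow_eq_pow_sum]
  calc (∏ k ∈ S, ((univ : Finset (Φ k)).filter (Q k)).card) * (∏ k ∈ Sᶜ, Fintype.card (Φ k)) *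
        ∏ k ∈ S, 2 ^ c k
      = (∏ k ∈ S, ((univ : Finset (Φ k)).filter (Q k)).card * 2 ^ c k) * ∏ k ∈ Sᶜ, Fintype.card (Φ k) := by
        rw [Finset.prod_mul_distrib]; ring
    _ ≤ (∏ k ∈ S, Fintype.card (Φ k)) * ∏ k ∈ Sᶜ, Fintype.card (Φ k) :=
        Nat.mul_le_mul_right _ (Finset.prod_le_prod' fun k hk => hdens k hk)

/-- The candidate heavy sets: subsets of weight `> W₀`. [folklore] -/
noncomputable def heavySets (w : K → ℕ) (W₀ : ℕ) : Finset (Finset K) :=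
  (univ : Finset K).powerset.filter fun S => W₀ < ∑ k ∈ S, w k

omit [DecidableEq K] in
/-- Membership in `heavySets`. [folklore] -/
theorem mem_heavySets {w : K → ℕ} {W₀ : ℕ} {S : Finset K} :
    S ∈ heavySets w W₀ ↔ W₀ < ∑ k ∈ S, w k := by
  simp [heavySets]

omit [DecidableEq K] in
/-- There are at most `2^{|K|}` heavy sets. [folklore] -/
theorem card_heavySets_le (w : K → ℕ) (W₀ : ℕ) : (heavySets w W₀).card ≤ 2 ^ Fintype.card K := by
  calc (heavySets w W₀).card ≤ (univ : Finset K).powerset.card := card_filter_le _ _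
    _ = 2 ^ Fintype.card K := by rw [card_powerset, card_univ]

/-- **The soundness count.** Tests `g ∈ 𝒢`, a consistency relation `Cons g F` on coin tuples,
per-coordinate predicates `Q g k` with densities `#{Q g k} · 2^{c k} ≤ |Φ k|`, weights `w`, and the
KEY IMPLICATION: a consistent test makes the set `{k | Q g k (F k)}` heavy (`> W₀`). If every heavy set
`S` has `m ≤ ∑_{k ∈ S} c k`, then `#{F | ∃ g ∈ 𝒢, Cons g F} · 2^m ≤ |𝒢| · 2^{|K|} · |∏ Φ|`.
[cite: Hirahara2022PartialMCSP, proof of Lemma 8.3 (soundness: "(1 − o(1)) λ w(B) ≤ |M| … which implies w(B) < θ") and proof of Thm. 8.5 (p. 31)] -/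
theorem card_filter_exists_consistent_mul_le {G : Type} (𝒢 : Finset G)
    (Cons : G → ((k : K) → Φ k) → Prop)
    (Q : G → (k : K) → Φ k → Prop) (c w : K → ℕ) (W₀ m : ℕ)
    (hkey : ∀ g ∈ 𝒢, ∀ F, Cons g F → W₀ < ∑ k ∈ univ.filter (fun k => Q g k (F k)), w k)
    (hdens : ∀ g ∈ 𝒢, ∀ k, ((univ : Finset (Φ k)).filter (Q g k)).card * 2 ^ c k ≤ Fintype.card (Φ k))
    (hm : ∀ S : Finset K, W₀ < ∑ k ∈ S, w k → m ≤ ∑ k ∈ S, c k) :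
    ((univ : Finset ((k : K) → Φ k)).filter fun F => ∃ g ∈ 𝒢, Cons g F).card * 2 ^ m ≤
      𝒢.card * 2 ^ Fintype.card K * Fintype.card ((k : K) → Φ k) := by
  -- indicator sums instead of unions (no decidable equality of coin tuples needed)
  set U := (univ : Finset ((k : K) → Φ k)) with hU
  have hind : ∀ F : (k : K) → Φ k, (if ∃ g ∈ 𝒢, Cons g F then (1 : ℕ) else 0) ≤
      ∑ g ∈ 𝒢, ∑ S ∈ heavySets w W₀, if ∀ k ∈ S, Q g k (F k) then 1 else 0 := by
    intro F
    split_ifs with h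
    · obtain ⟨g, hg, hc⟩ := h
      have hS : univ.filter (fun k => Q g k (F k)) ∈ heavySets w W₀ := mem_heavySets.2 (hkey g hg F hc)
      calc (1 : ℕ) = if ∀ k ∈ univ.filter (fun k => Q g k (F k)), Q g k (F k) then 1 else 0 := by
            rw [if_pos fun k hk => (mem_filter.1 hk).2]
        _ ≤ ∑ S ∈ heavySets w W₀, if ∀ k ∈ S, Q g k (F k) then 1 else 0 :=
            Finset.single_le_sum (f := fun S => if ∀ k ∈ S, Q g k (F k) then 1 else 0)
              (fun _ _ => Nat.zero_le _) hS
        _ ≤ ∑ g ∈ 𝒢, ∑ S ∈ heavySets w W₀, if ∀ k ∈ S, Q g k (F k) then 1 else 0 :=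
            Finset.single_le_sum (f := fun g => ∑ S ∈ heavySets w W₀, if ∀ k ∈ S, Q g k (F k) then 1 else 0)
              (fun _ _ => Nat.zero_le _) hg
    · exact Nat.zero_le _
  have hcard : (U.filter fun F => ∃ g ∈ 𝒢, Cons g F).card ≤
      ∑ g ∈ 𝒢, ∑ S ∈ heavySets w W₀, (U.filter fun F => ∀ k ∈ S, Q g k (F k)).card := by
    calc (U.filter fun F => ∃ g ∈ 𝒢, Cons g F).card
        = ∑ F ∈ U, if ∃ g ∈ 𝒢, Cons g F then 1 else 0 := by rw [Finset.sum_boole]; simp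
      _ ≤ ∑ F ∈ U, ∑ g ∈ 𝒢, ∑ S ∈ heavySets w W₀, if ∀ k ∈ S, Q g k (F k) then 1 else 0 :=
          sum_le_sum fun F _ => hind F
      _ = ∑ g ∈ 𝒢, ∑ S ∈ heavySets w W₀, ∑ F ∈ U, if ∀ k ∈ S, Q g k (F k) then 1 else 0 := by
          rw [Finset.sum_comm]; exact sum_congr rfl fun g _ => Finset.sum_comm
      _ = ∑ g ∈ 𝒢, ∑ S ∈ heavySets w W₀, (U.filter fun F => ∀ k ∈ S, Q g k (F k)).card := by
          refine sum_congr rfl fun g _ => sum_congr rfl fun S _ => ?_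
          rw [Finset.sum_boole]; simp
  -- each piece
  have hpiece : ∀ g ∈ 𝒢, ∀ S ∈ heavySets w W₀,
      (U.filter fun F => ∀ k ∈ S, Q g k (F k)).card * 2 ^ m ≤ Fintype.card ((k : K) → Φ k) := by
    intro g hg S hS
    have hSm : m ≤ ∑ k ∈ S, c k := hm S (mem_heavySets.1 hS)
    calc (U.filter fun F => ∀ k ∈ S, Q g k (F k)).card * 2 ^ m
        ≤ (U.filter fun F => ∀ k ∈ S, Q g k (F k)).card * 2 ^ (∑ k ∈ S, c k) :=
          Nat.mul_le_mul_left _ (Nat.pow_le_pow_right (by norm_num) hSm)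
      _ ≤ Fintype.card ((k : K) → Φ k) :=
          card_filter_forall_mul_le S (Q g) c fun k _ => hdens g hg k
  calc (U.filter fun F => ∃ g ∈ 𝒢, Cons g F).card * 2 ^ m
      ≤ (∑ g ∈ 𝒢, ∑ S ∈ heavySets w W₀, (U.filter fun F => ∀ k ∈ S, Q g k (F k)).card) * 2 ^ m :=
        Nat.mul_le_mul_right _ hcard
    _ = ∑ g ∈ 𝒢, ∑ S ∈ heavySets w W₀, (U.filter fun F => ∀ k ∈ S, Q g k (F k)).card * 2 ^ m := by
        rw [Finset.sum_mul]; exact sum_congr rfl fun g _ => Finset.sum_mul _ _ _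
    _ ≤ ∑ _g ∈ 𝒢, ∑ _S ∈ heavySets w W₀, Fintype.card ((k : K) → Φ k) :=
        sum_le_sum fun g hg => sum_le_sum fun S hS => hpiece g hg S hS
    _ = 𝒢.card * ((heavySets w W₀).card * Fintype.card ((k : K) → Φ k)) := by
        simp only [sum_const, nsmul_eq_mul, Nat.cast_id]
    _ ≤ 𝒢.card * (2 ^ Fintype.card K * Fintype.card ((k : K) → Φ k)) :=
        Nat.mul_le_mul_left _ (Nat.mul_le_mul_right _ (card_heavySets_le w W₀))
    _ = 𝒢.card * 2 ^ Fintype.card K * Fintype.card ((k : K) → Φ k) := by ring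

end SoundnessCounting

end Literature.Computability.Complexity
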